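import Mathlib

/-!
# Square-difference-free sets in quadratic orders `ℤ[√κ]` by Ruzsa digits (density exponent `3/4`)
(wall-breaker axis `parabola lifts over finite fields`, stub `stub_tangencySets` of the crux `LevelOneGL2Designs`,
stmt-MatrixMultiplication-14080; companion files `…TangencyQuadraticLift`, `…TangencyQuadraticLiftAllPrimes`)

The parabola lift turns a set with no two elements differing by a square into a strong representative system
(induced point–line matching) of `AG(2,p)`; Hunter–Pohoata–Verstraëte–Zhang (2026, arXiv:2601.19879, Thm 1.2)
lift Ruzsa's square-difference-free INTEGER sets (`N^{0.7334}`) and get `IM(2,p) ≫ p^{1.2334}`.  This file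
supplies the combinatorial input of a better lift: square-difference-free sets in a quadratic ORDER `ℤ[√κ] ≅ ℤ²`
(pairs `(x, y)`; the square of `(n₁, n₂)` is `(n₁² + κ n₂², 2 n₁ n₂)`).  Ruzsa's digit method in base a rational
prime `q` that stays prime in `ℤ[√κ]` has residue field `𝔽_{q²}`, whose Paley graph has cocliques `ω·𝔽_q` of
size exactly `q = √(q²)`; so even-position digits may be taken from a set of `q` residues while odd-position
digits are free, giving `|T| = (q · q²)^k = q^{3k}` inside the box `[0, q^{2k})²` of area `q^{4k}` — density
exponent `3/4`, the natural endpoint of the digit method, unattainable over `ℤ` (record `0.7334`, Lewko 2015).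

* `quadDigits_eq_zero` — no wrap-around: if `K² = κ (mod p)` and `u + K v ≡ 0` with `|u² − κ v²| < p` then
  `u = v = 0` (the norm form of `ℤ[√κ]` is anisotropic);
* `quadSqDiffFree_digitStep`, `exists_quadSqDiffFree_digits` — Ruzsa's digit construction in `ℤ[√κ]`, with
  the primality of `q` in the order and the coclique property of the residue set `R` as decidable hypotheses
  (instances `κ = −1, 2, −2` with `q = 3, 3, 5` are decided in `…TangencyQuadraticLiftAllPrimes`; the case
  `κ = −1` is also in `…GaussLiftDigits`, seat k2, found independently).

Elementary and fully proved; no definitions. [cite: Ruzsa1984DifferenceSetsWithoutSquares, §2 (the method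
over `ℤ`)]
-/

-- the summit/problem path `MatrixMultiplication.MatrixMultiplication` is fixed by the tree layout (D-0017)
set_option linter.dupNamespace false

noncomputable section

open Finset Matrix

namespace Summit.MatrixMultiplication.MatrixMultiplication.Theorems.LevelOneGL2Designs.ParabolaLift

section Norm

/-- If `u² = κ·v²` in `ℤ` with `κ` not a perfect square then `u = v = 0`. [elementary] -/
theorem eq_zero_of_sq_eq_nonsquare_mul_sq {κ u v : ℤ} (hκ : ¬ IsSquare κ) (h : u ^ 2 = κ * v ^ 2) :
    u = 0 ∧ v = 0 := by
  by_cases hv : v = 0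
  · subst hv
    have hu : u ^ 2 = 0 := by simpa using h
    exact ⟨pow_eq_zero_iff two_ne_zero |>.mp hu, rfl⟩
  · exfalso
    have hdvd : v ^ 2 ∣ u ^ 2 := ⟨κ, by rw [h]; ring⟩
    obtain ⟨w, rfl⟩ := (Int.pow_dvd_pow_iff two_ne_zero).mp hdvd
    apply hκ
    refine ⟨w, ?_⟩
    have hv2 : v ^ 2 ≠ 0 := pow_ne_zero 2 hv
    have : κ * v ^ 2 = (w * w) * v ^ 2 := by rw [← h]; ring
    exact mul_right_cancel₀ hv2 this

/-- **No wrap-around for quadratic digits.**  Let `K² = κ` in `ZMod p` with `κ ∈ ℤ` not a perfect square.  If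
`u + K·v = 0` in `ZMod p` for integers `u, v` with `|u² − κ v²| < p`, then `u = v = 0`: multiplying by `u − K·v`
gives `p ∣ u² − κ v²`, a non-zero integer (as `κ` is not a square) of absolute value `< p`.  This is the norm form
of the order `ℤ[√κ]` detecting injectivity of `ℤ[√κ] → 𝔽_p`, `√κ ↦ K`, on a box. [elementary] -/
theorem quadDigits_eq_zero {p : ℕ} [Fact p.Prime] {κ : ℤ} (hκ : ¬ IsSquare κ) {K : ZMod p}
    (hK : K ^ 2 = (κ : ZMod p)) {u v : ℤ} (huv : |u ^ 2 - κ * v ^ 2| < p)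
    (h : (u : ZMod p) + K * v = 0) : u = 0 ∧ v = 0 := by
  have hnorm : ((u ^ 2 - κ * v ^ 2 : ℤ) : ZMod p) = 0 := by
    push_cast
    have h2 : ((u : ZMod p) + K * v) * ((u : ZMod p) - K * v) = 0 := by rw [h, zero_mul]
    linear_combination h2 + (v : ZMod p) ^ 2 * hK
  rw [ZMod.intCast_zmod_eq_zero_iff_dvd] at hnorm
  have h0 : u ^ 2 - κ * v ^ 2 = 0 := Int.eq_zero_of_abs_lt_dvd hnorm huv
  exact eq_zero_of_sq_eq_nonsquare_mul_sq hκ (by linear_combination h0)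

end Norm

section Digits

/-- **Ruzsa's digit step in the order `ℤ[√κ]`.**  Elements of `ℤ[√κ] = {x + y√κ}` are coded as pairs; the square
of `n₁ + n₂√κ` is `(n₁² + κ n₂²) + 2n₁n₂ √κ`.  Let `q` be a (rational) prime of `ℤ[√κ]` in the decidable form
`hprime` (`q ∣ z²  ⇒  q ∣ z`), and let `R ⊆ [0,q)²` be a set of residues no two of which differ by a square
modulo `q`.  If `B ⊆ [0, L)²` has no two elements differing by a non-trivial square of `ℤ[√κ]`, then neither has
`A = {r + q·d + q²·b : r ∈ R, d ∈ [0,q)², b ∈ B} ⊆ [0, q²L)²` (coordinatewise digits), and `|A| = |R|·q²·|B|`.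
(Lowest digit: a square difference is `≡ r − r' (mod q)`, excluded by `R` unless `r = r'`; then `q ∣ n²`, so
`q ∣ n`, the middle digits agree and `b − b' = (n/q)²`.) [cite: Ruzsa1984DifferenceSetsWithoutSquares, §2;
adapted from `ℤ` to `ℤ[√κ]`] -/
theorem quadSqDiffFree_digitStep (κ : ℤ) (q : ℕ) (hq : 0 < q)
    (hprime : ∀ x y : ZMod q, x ^ 2 + (κ : ZMod q) * y ^ 2 = 0 → 2 * x * y = 0 → x = 0 ∧ y = 0)
    (R : Finset (ℕ × ℕ)) (hRq : ∀ r ∈ R, r.1 < q ∧ r.2 < q)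
    (hR : ∀ r ∈ R, ∀ r' ∈ R, ∀ x y : ZMod q,
      x ^ 2 + (κ : ZMod q) * y ^ 2 + (r'.1 : ZMod q) = r.1 → 2 * x * y + (r'.2 : ZMod q) = r.2 → r = r')
    (B : Finset (ℕ × ℕ)) (L : ℕ) (hBL : ∀ b ∈ B, b.1 < L ∧ b.2 < L)
    (hB : ∀ a ∈ B, ∀ b ∈ B, ∀ n₁ n₂ : ℤ, (a.1 : ℤ) = b.1 + (n₁ ^ 2 + κ * n₂ ^ 2) →
      (a.2 : ℤ) = b.2 + 2 * n₁ * n₂ → a = b) :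
    ∃ A : Finset (ℕ × ℕ), (∀ a ∈ A, a.1 < q * q * L ∧ a.2 < q * q * L) ∧
      A.card = R.card * (q * q) * B.card ∧
      ∀ a ∈ A, ∀ b ∈ A, ∀ n₁ n₂ : ℤ, (a.1 : ℤ) = b.1 + (n₁ ^ 2 + κ * n₂ ^ 2) →
        (a.2 : ℤ) = b.2 + 2 * n₁ * n₂ → a = b := by
  classical
  -- digit decoding: `r + q * u` with `r < q` determines `r` and `u`
  have decode : ∀ r u r' u' : ℕ, r < q → r' < q → r + q * u = r' + q * u' → r = r' ∧ u = u' := by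
    intro r u r' u' hr hr' h
    have h1 : (r + q * u) % q = (r' + q * u') % q := by rw [h]
    rw [Nat.add_mul_mod_self_left, Nat.add_mul_mod_self_left, Nat.mod_eq_of_lt hr,
      Nat.mod_eq_of_lt hr'] at h1
    subst h1
    refine ⟨rfl, ?_⟩
    have h2 : q * u = q * u' := by omega
    exact Nat.eq_of_mul_eq_mul_left hq h2
  -- the same, for an integer equation `r + q*u = r' + q*u'` with `u, u' : ℤ`
  have decodeZ : ∀ r r' : ℕ, ∀ u u' : ℤ, r < q → r' < q →
      (r : ℤ) + q * u = r' + q * u' → r = r' ∧ u = u' := by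
    intro r r' u u' hr hr' h
    have hcast : ((r : ℤ) : ZMod q) = ((r' : ℤ) : ZMod q) := by
      have h1 := congrArg (Int.cast : ℤ → ZMod q) h
      push_cast at h1
      simpa [ZMod.natCast_self] using h1
    push_cast at hcast
    rw [ZMod.natCast_eq_natCast_iff', Nat.mod_eq_of_lt hr, Nat.mod_eq_of_lt hr'] at hcast
    subst hcast
    refine ⟨rfl, ?_⟩
    have hq0 : (q : ℤ) ≠ 0 := by exact_mod_cast hq.ne'
    have h2 : (q : ℤ) * u = q * u' := by linarith
    exact mul_left_cancel₀ hq0 h2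
  let enc : (ℕ × ℕ) × (ℕ × ℕ) × (ℕ × ℕ) → ℕ × ℕ := fun x =>
    (x.1.1 + q * (x.2.1.1 + q * x.2.2.1), x.1.2 + q * (x.2.1.2 + q * x.2.2.2))
  have enc1 : ∀ x, (enc x).1 = x.1.1 + q * (x.2.1.1 + q * x.2.2.1) := fun x => rfl
  have enc2 : ∀ x, (enc x).2 = x.1.2 + q * (x.2.1.2 + q * x.2.2.2) := fun x => rfl
  refine ⟨(R ×ˢ ((range q ×ˢ range q) ×ˢ B)).image enc, ?_, ?_, ?_⟩
  · -- range bound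
    simp only [mem_image, mem_product, mem_range]
    rintro _ ⟨⟨r, d, b⟩, ⟨hr, ⟨hd1, hd2⟩, hb⟩, rfl⟩
    rw [enc1, enc2]
    obtain ⟨hr1, hr2⟩ := hRq r hr
    obtain ⟨hb1, hb2⟩ := hBL b hb
    constructor
    · have h1 : d.1 + q * b.1 + 1 ≤ q * L := by nlinarith
      nlinarith
    · have h1 : d.2 + q * b.2 + 1 ≤ q * L := by nlinarith
      nlinarith
  · -- cardinality
    rw [card_image_of_injOn, card_product, card_product, card_product, card_range]
    · ring
    rintro ⟨r, d, b⟩ hx ⟨r', d', b'⟩ hx' h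
    simp only [coe_product, Set.mem_prod, mem_coe, mem_range] at hx hx'
    have h1 := congrArg Prod.fst h
    have h2 := congrArg Prod.snd h
    rw [enc1, enc1] at h1
    rw [enc2, enc2] at h2
    obtain ⟨e1, f1⟩ := decode _ _ _ _ (hRq r hx.1).1 (hRq r' hx'.1).1 h1
    obtain ⟨e2, f2⟩ := decode _ _ _ _ (hRq r hx.1).2 (hRq r' hx'.1).2 h2
    obtain ⟨e3, f3⟩ := decode _ _ _ _ hx.2.1.1 hx'.2.1.1 f1
    obtain ⟨e4, f4⟩ := decode _ _ _ _ hx.2.1.2 hx'.2.1.2 f2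
    have er : r = r' := Prod.ext e1 e2
    have ed : d = d' := Prod.ext e3 e4
    have eb : b = b' := Prod.ext f3 f4
    subst er; subst ed; subst eb; rfl
  · -- no square differences
    simp only [mem_image, mem_product, mem_range]
    rintro _ ⟨⟨r, d, b⟩, ⟨hr, ⟨hd1, hd2⟩, hb⟩, rfl⟩ _ ⟨⟨r', d', b'⟩, ⟨hr', ⟨hd1', hd2'⟩, hb'⟩, rfl⟩
      n₁ n₂ h1 h2
    rw [enc1, enc1] at h1
    rw [enc2, enc2] at h2
    push_cast at h1 h2
    -- the lowest digit: `n² + r' ≡ r (mod q)`, so `r = r'`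
    have hrr : r = r' := by
      apply hR r hr r' hr' (n₁ : ZMod q) (n₂ : ZMod q)
      · have h3 := congrArg (Int.cast : ℤ → ZMod q) h1
        push_cast at h3
        simp only [ZMod.natCast_self, zero_mul, add_zero] at h3
        linear_combination -h3
      · have h3 := congrArg (Int.cast : ℤ → ZMod q) h2
        push_cast at h3
        simp only [ZMod.natCast_self, zero_mul, add_zero] at h3
        linear_combination -h3
    subst hrr
    -- `q ∣ n²` in `ℤ[√κ]`, hence `q ∣ n`
    have h1' : (q : ℤ) * (d.1 + q * b.1) = q * (d'.1 + q * b'.1) + (n₁ ^ 2 + κ * n₂ ^ 2) := by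
      linear_combination h1
    have h2' : (q : ℤ) * (d.2 + q * b.2) = q * (d'.2 + q * b'.2) + 2 * n₁ * n₂ := by
      linear_combination h2
    have hz1 : ((n₁ : ZMod q)) ^ 2 + (κ : ZMod q) * (n₂ : ZMod q) ^ 2 = 0 := by
      have h3 := congrArg (Int.cast : ℤ → ZMod q) h1'
      push_cast at h3
      simp only [ZMod.natCast_self, zero_mul, zero_add] at h3
      linear_combination -h3
    have hz2 : 2 * (n₁ : ZMod q) * (n₂ : ZMod q) = 0 := by
      have h3 := congrArg (Int.cast : ℤ → ZMod q) h2'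
      push_cast at h3
      simp only [ZMod.natCast_self, zero_mul, zero_add] at h3
      linear_combination -h3
    obtain ⟨hn1, hn2⟩ := hprime _ _ hz1 hz2
    rw [ZMod.intCast_zmod_eq_zero_iff_dvd] at hn1 hn2
    obtain ⟨m₁, rfl⟩ := hn1
    obtain ⟨m₂, rfl⟩ := hn2
    have hq0 : (q : ℤ) ≠ 0 := by exact_mod_cast hq.ne'
    -- divide by `q`: the middle digits
    have h1'' : (d.1 : ℤ) + q * b.1 = d'.1 + q * (b'.1 + (m₁ ^ 2 + κ * m₂ ^ 2)) := by
      apply mul_left_cancel₀ hq0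
      linear_combination h1'
    have h2'' : (d.2 : ℤ) + q * b.2 = d'.2 + q * (b'.2 + 2 * m₁ * m₂) := by
      apply mul_left_cancel₀ hq0
      linear_combination h2'
    obtain ⟨e1, f1⟩ := decodeZ _ _ _ _ hd1 hd1' h1''
    obtain ⟨e2, f2⟩ := decodeZ _ _ _ _ hd2 hd2' h2''
    -- the top digits: `b − b'` is the square of `m`
    have hbb : b = b' := hB b hb b' hb' m₁ m₂ (by linear_combination f1) (by linear_combination f2)
    subst hbb
    have ed : d = d' := Prod.ext e1 e2
    subst ed
    rfl

/-- **Ruzsa's digit construction in `ℤ[√κ]`, iterated.**  With `q`, `R` as in `quadSqDiffFree_digitStep`, for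
every `k` there is `A ⊆ [0, q^{2k})²` of size `(|R|·q²)^k` with no two elements differing by a non-trivial square
of `ℤ[√κ]`.  For `q` inert in `ℤ[√κ]` one can take `|R| = q` (a Paley-type coclique `ω·𝔽_q ⊆ 𝔽_{q²}`), giving
`|A| = q^{3k} = (area)^{3/4}` — the exponent `3/4` that the digit method cannot reach over `ℤ`.
[cite: Ruzsa1984DifferenceSetsWithoutSquares, §2; adapted] -/
theorem exists_quadSqDiffFree_digits (κ : ℤ) (q : ℕ) (hq : 0 < q)
    (hprime : ∀ x y : ZMod q, x ^ 2 + (κ : ZMod q) * y ^ 2 = 0 → 2 * x * y = 0 → x = 0 ∧ y = 0)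
    (R : Finset (ℕ × ℕ)) (hRq : ∀ r ∈ R, r.1 < q ∧ r.2 < q)
    (hR : ∀ r ∈ R, ∀ r' ∈ R, ∀ x y : ZMod q,
      x ^ 2 + (κ : ZMod q) * y ^ 2 + (r'.1 : ZMod q) = r.1 → 2 * x * y + (r'.2 : ZMod q) = r.2 → r = r')
    (k : ℕ) :
    ∃ A : Finset (ℕ × ℕ), (∀ a ∈ A, a.1 < q ^ (2 * k) ∧ a.2 < q ^ (2 * k)) ∧
      A.card = (R.card * (q * q)) ^ k ∧
      ∀ a ∈ A, ∀ b ∈ A, ∀ n₁ n₂ : ℤ, (a.1 : ℤ) = b.1 + (n₁ ^ 2 + κ * n₂ ^ 2) →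
        (a.2 : ℤ) = b.2 + 2 * n₁ * n₂ → a = b := by
  induction k with
  | zero =>
    refine ⟨{(0, 0)}, by simp, by simp, ?_⟩
    intro a ha b hb _ _ _ _
    rw [mem_singleton] at ha hb
    rw [ha, hb]
  | succ k ih =>
    obtain ⟨B, hBL, hBcard, hB⟩ := ih
    obtain ⟨A, hAL, hAcard, hA⟩ :=
      quadSqDiffFree_digitStep κ q hq hprime R hRq hR B (q ^ (2 * k)) hBL hB
    refine ⟨A, fun a ha => ?_, by rw [hAcard, hBcard]; ring, hA⟩
    have h := hAL a ha
    have e : q * q * q ^ (2 * k) = q ^ (2 * (k + 1)) := by ring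
    exact ⟨e ▸ h.1, e ▸ h.2⟩

end Digits

end Summit.MatrixMultiplication.MatrixMultiplication.Theorems.LevelOneGL2Designs.ParabolaLift
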